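import Mathlib

/-!
# P4FermatQuotient — kernel-checked identities behind proofs/p4-k3-fermat-quotient.md (pub-hodge-repro0)

The census K3 surface `Ỹ_λ` = minimal model of `(C_λ × C_λ)/D_m`, `C_λ : y^m = x^{a₀}(x−1)^{a₁}(x−λ)^{a₂}`, is birational
to the `m`-cyclic cover of `ℙ²` branched along four lines in general position, hence a quotient of the Fermat surface `X²_m`.
The algebra behind it is finite and is certified here (ROUTE R-5 corroboration; the Hodge theory lives in the note):
* `swap_relation` (Prop 1(b)): with `u = y y′`, `s₁ = x + x′`, `s₂ = x x′`,
  `u^m = f(x) f(x′) = s₂^{a₀} (s₂ − s₁ + 1)^{a₁} (s₂ − λ s₁ + λ²)^{a₂}` — for ALL exponents and all `x, x′, λ`;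
* `general_position` (Prop 1(c)): the three affine branch lines meet pairwise in the three DISTINCT points
  `(1,0), (λ,0), (1+λ, λ)` and have the three distinct slopes `0, 1, λ`, for every `λ ∉ {0, 1}`;
* `fermat_map_identity` (Prop 2(c)): on `X²_m` (`X₃^m = −(X₀^m + X₁^m + X₂^m)`), `u := X₀^{a₀}X₁^{a₁}X₂^{a₂}X₃^{a₃}` satisfies
  `u^m = x₀^{a₀} x₁^{a₁} x₂^{a₂} x₃^{a₃}` with `x_i = X_i^m`, `x₃ = −(x₀ + x₁ + x₂)` — for ALL exponents, over any commutative ring;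
* `census_rows_ok`: for the nine families used in the note the weights sum to `0 mod m` and `gcd(a₀, a₁, a₂, a₃, m) = 1`.
-/

namespace HodgeRepro0.P4FermatQuotient

/-- `(x − a)(x′ − a) = s₂ − a s₁ + a²` (the one-line identity behind Prop 1(b)). -/
theorem pair_identity {R : Type*} [CommRing R] (x x' a : R) :
    (x - a) * (x' - a) = x * x' - a * (x + x') + a ^ 2 := by ring

/-- Prop 1(b): the swap-invariant relation `u^m = f(x) f(x′) = F_λ(s₁, s₂)`, for all exponents. -/
theorem swap_relation {R : Type*} [CommRing R] (x x' lam : R) (a₀ a₁ a₂ : ℕ) :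
    (x ^ a₀ * (x - 1) ^ a₁ * (x - lam) ^ a₂) * (x' ^ a₀ * (x' - 1) ^ a₁ * (x' - lam) ^ a₂)
      = (x * x') ^ a₀ * (x * x' - (x + x') + 1) ^ a₁ * (x * x' - lam * (x + x') + lam ^ 2) ^ a₂ := by
  have h1 : x * x' - (x + x') + 1 = (x - 1) * (x' - 1) := by ring
  have h2 : x * x' - lam * (x + x') + lam ^ 2 = (x - lam) * (x' - lam) := by ring
  rw [h1, h2, mul_pow, mul_pow, mul_pow]
  ring

/-- Prop 1(c): the pairwise intersection points of `L₀ : s₂ = 0`, `L₁ : s₂ − s₁ + 1 = 0`, `L_λ : s₂ − λ s₁ + λ² = 0`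
lie on the respective lines, and for `λ ∉ {0, 1}` the three points and the three slopes `0, 1, λ` are pairwise distinct. -/
theorem general_position {F : Type*} [Field F] (lam : F) (h0 : lam ≠ 0) (h1 : lam ≠ 1) :
    -- (1,0) ∈ L₀ ∩ L₁ ; (λ,0) ∈ L₀ ∩ L_λ ; (1+λ, λ) ∈ L₁ ∩ L_λ
    ((0:F) = 0 ∧ (0:F) - 1 + 1 = 0) ∧ ((0:F) = 0 ∧ (0:F) - lam * lam + lam ^ 2 = 0) ∧
    (lam - (1 + lam) + 1 = 0 ∧ lam - lam * (1 + lam) + lam ^ 2 = 0) ∧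
    -- the three points are pairwise distinct (already in the first coordinate)
    ((1:F) ≠ lam ∧ (1:F) ≠ 1 + lam ∧ lam ≠ 1 + lam) ∧
    -- the three slopes are pairwise distinct
    ((0:F) ≠ 1 ∧ (0:F) ≠ lam ∧ (1:F) ≠ lam) := by
  refine ⟨⟨rfl, by ring⟩, ⟨rfl, by ring⟩, ⟨by ring, by ring⟩, ⟨?_, ?_, ?_⟩, ⟨zero_ne_one, ?_, ?_⟩⟩
  · exact fun h => h1 h.symm
  · intro h; apply h0; linear_combination -h
  · intro h; apply one_ne_zero (α := F); linear_combination -h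
  · exact fun h => h0 h.symm
  · exact fun h => h1 h.symm

/-- Prop 2(c): the Fermat map identity on `X²_m`, for all exponents, over any commutative ring. -/
theorem fermat_map_identity {R : Type*} [CommRing R] (m a₀ a₁ a₂ a₃ : ℕ) (X₀ X₁ X₂ X₃ : R)
    (h : X₃ ^ m = -(X₀ ^ m + X₁ ^ m + X₂ ^ m)) :
    (X₀ ^ a₀ * X₁ ^ a₁ * X₂ ^ a₂ * X₃ ^ a₃) ^ m
      = (X₀ ^ m) ^ a₀ * (X₁ ^ m) ^ a₁ * (X₂ ^ m) ^ a₂ * (-(X₀ ^ m + X₁ ^ m + X₂ ^ m)) ^ a₃ := by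
  rw [← h]
  ring

/-- the nine families used in the note: `(m; a₀, a₁, a₂, a₃)` -/
def rows : List (Nat × Nat × Nat × Nat × Nat) :=
  [(12, 1, 2, 3, 6), (12, 1, 3, 4, 4), (12, 2, 3, 3, 4), (12, 4, 6, 7, 7),
   (10, 1, 2, 3, 4), (10, 1, 1, 3, 5), (8, 1, 2, 2, 3), (12, 1, 3, 10, 10), (12, 1, 2, 4, 5)]

/-- weights sum to `0 (mod m)` and `gcd(a₀, a₁, a₂, a₃, m) = 1`, row by row -/
def rowOk : Nat × Nat × Nat × Nat × Nat → Bool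
  | (m, a₀, a₁, a₂, a₃) =>
    (a₀ + a₁ + a₂ + a₃) % m == 0 && Nat.gcd (Nat.gcd (Nat.gcd (Nat.gcd a₀ a₁) a₂) a₃) m == 1
      && 0 < a₀ && a₀ < m && 0 < a₁ && a₁ < m && 0 < a₂ && a₂ < m && 0 < a₃ && a₃ < m

/-- every row of `rows` passes `rowOk` (kernel-checked by `decide`). -/
theorem census_rows_ok : rows.all rowOk = true := by decide

end HodgeRepro0.P4FermatQuotient
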